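import Summits.Ventures.HSemireg.WedgeHankelRecurrenceGaussChebyshevPowerSeries

/-!
# Venture HSemireg — **MARKOV'S INEQUALITY FOR THE SECOND KIND: `|U_n′(x)| ≤ U_n′(1) = n(n+1)(n+2)∕3` on `[−1, 1]` and `|S_n′(x)| ≤ S_n′(2) = n(n+1)(n+2)∕6` on `[−2, 2]`**, through the positive
# expansions `U_{2m+1}′ = Σ_{k≤m} 2(2k+1)U_{2k}`, `U_{2m+2}′ = Σ_{k≤m} 2(2k+2)U_{2k+1}`, `S_{2m+1}′ = Σ_{k≤m} (2k+1)S_{2k}`, `S_{2m+2}′ = Σ_{k≤m} (2k+2)S_{2k+1}` (every commutative ring) and the bounds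
# `|U_j| ≤ j + 1 = U_j(1)`, `|S_j| ≤ j + 1 = S_j(2)`

HONEST FRAMING. Part of the Lean index of the computation cell `pub-hsemireg` (seat p10 gen 49, Sunday typer «UNIFORM-IN-n»).  Polynomial algebra with the formal derivative and real inequalities
(Mathlib `Polynomial.Chebyshev.T ∕ U ∕ C ∕ S`, `Polynomial.derivative`); no variety, no cohomology theory, no sheaf, no Ext group and no semiregularity map is constructed here; nothing here says that HC /
HC_CM / HC_AV holds; no Literature fact (unproved `Prop`) is declared or used.  Custodian versions as in `WedgeHankelSiegelIdeal` (1/3).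
SOURCES (cited).  A. A. Markov (1889) ∕ V. A. Markov (1892), see T. J. Rivlin, *The Chebyshev Polynomials* (Wiley 1974), §2.7 and (1.97)–(1.98) (`T_n′(1) = n²`, `U_n′(1) = n(n+1)(n+2)∕3`);
J. C. Mason, D. C. Handscomb, *Chebyshev Polynomials* (2003), §2.4.5 (`U_n′` in the `U`-basis); P. Borwein, T. Erdélyi, *Polynomials and Polynomial Inequalities* (Springer 1995), §5.1 E.
PROOF TYPED HERE.  (1) Differentiate the Dirichlet-kernel identities of N538 (`S_{2m+1} = Σ C_{2k+1}`, `S_{2m+2} = 1 + Σ C_{2k+2}`) with N510 `chebyshevC_derivative_eq_S` (`C_j′ = jS_{j−1}`), and transport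
to `U` through `U_n = S_n(2X)` (Mathlib `S_comp_two_mul_X`, `derivative_comp`: `(p(2X))′ = 2p′(2X)`); (2) triangle inequality (`Finset.abs_sum_le_sum_abs`) with the LANDED `Literature…abs_eval_U_le`
(`|U_j| ≤ j+1` on `[−1,1]`) resp. its `x∕2` transport (N521 `chebyshevS_eval_eq_U_eval_half`), and `U_j(1) = j + 1`, `S_j(2) = j + 1` (Mathlib); (3) the closed values `U_n′(1)` (Mathlib
`derivative_U_eval_one_eq_div`) and `S_n′(2)` (N513 `six_mul_derivative_S_eval_two`).
DEDUP DISCLOSURE (`rg -n 'abs_eval_derivative_U|derivative \\(Polynomial.Chebyshev.U|derivative \\(U ' Summits/Ventures/HSemireg Literature`, 2026-09-04): N444 `WedgeHankelRecurrenceGaussChebyshevMarkovBound` has the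
FIRST-kind bounds `|T_n^{(k)}(x)| ≤ T_n^{(k)}(1)` (from Mathlib `abs_iterate_derivative_T_real_le`) and `abs_eval_chebyshevU_real_le_min`; `Literature.Analysis.Approximation.ChebyshevPointsExercises`
(`abs_derivative_T_eval_lt_sq`, Rivlin Ex. 1.5) and `…ChebyshevExtremaInterpolation` (`duffinSchaeffer_abs_derivative_eval_le`) are again FIRST-kind statements; the `T`-sums `U_{2k+1} = 2Σ T_{2j+1}`,
`U_{2k} = 1 + 2Σ T_{2j+2}` whose derivatives give (1) directly are `Literature…ChebyshevExplicitForms.U_two_mul_add_one_eq_two_mul_sum ∕ U_two_mul_eq_one_add_two_mul_sum` (cited; that module imports all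
of Mathlib and is not imported); no derivative bound for `U_n` or `S_n`, and no `U`-basis expansion of `U_n′`, in Mathlib or the tree; 0 hits for the 9 names below.

WHAT IS IN THE TREE.  N538 `sum_chebyshevC_odd`, `one_add_sum_chebyshevC_even`; N510 `chebyshevC_derivative_eq_S`; N521 `chebyshevS_eval_eq_U_eval_half`; `Literature…FitznerVanDerHofstad2017.abs_eval_U_le`;
Mathlib `S_comp_two_mul_X`, `derivative_comp`, `sum_comp`, `intCast_comp`, `derivative_sum`, `U_eval_one`, `S_eval_two`, `derivative_U_eval_one_eq_div`, `Finset.abs_sum_le_sum_abs`; N513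
`six_mul_derivative_S_eval_two`.
THIS FILE (namespace `Summit.Ventures.HSemireg.Wedge.HankelOuter` continued; CHAINED on N541; 0 definitions):
* §1307 **`derivative_chebyshevS_odd`**, **`derivative_chebyshevS_even`**, `derivative_comp_two_mul_X`, **`derivative_chebyshevU_odd`**, **`derivative_chebyshevU_even`** (the expansions, every commutative ring);
  **`abs_eval_derivative_chebyshevU_real_le`** (`|x| ≤ 1 ⇒ |U_n′(x)| ≤ U_n′(1)`), `abs_eval_derivative_chebyshevU_real_le_explicit` (`≤ n(n+1)(n+2)∕3`), **`abs_eval_derivative_chebyshevS_real_le`**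
  (`|x| ≤ 2 ⇒ |S_n′(x)| ≤ S_n′(2)`), `abs_eval_derivative_chebyshevS_real_le_explicit` (`≤ n(n+1)(n+2)∕6`).
CAVEATS.  First derivative only (higher derivatives of `U_n` are not sign-regular in the `U`-basis in the same simple way).  Nothing Ext-side.  New names only.
-/

open Module Polynomial
open scoped Matrix Polynomial

namespace Summit.Ventures.HSemireg.Wedge.HankelOuter

/-! ## §1307. Markov's inequality for `U_n` and `S_n` -/

/-! ### The expansions of `S_n′`, `U_n′` -/

/-- **`S_{2m+1}′ = Σ_{k≤m} (2k+1)·S_{2k}`** in every commutative ring. [this file, §1307] -/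
theorem derivative_chebyshevS_odd (R : Type*) [CommRing R] (m : ℕ) :
    derivative (Polynomial.Chebyshev.S R (2 * (m : ℤ) + 1)) = ∑ k ∈ Finset.range (m + 1), ((2 * (k : ℤ) + 1 : ℤ) : R[X]) * Polynomial.Chebyshev.S R (2 * (k : ℤ)) := by
  have h := congrArg derivative (sum_chebyshevC_odd R m)
  rw [← h, derivative_sum]
  refine Finset.sum_congr rfl fun k _ => ?_
  rw [chebyshevC_derivative_eq_S, show 2 * (k : ℤ) + 1 - 1 = 2 * (k : ℤ) by ring]

/-- **`S_{2m+2}′ = Σ_{k≤m} (2k+2)·S_{2k+1}`** in every commutative ring. [this file, §1307] -/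
theorem derivative_chebyshevS_even (R : Type*) [CommRing R] (m : ℕ) :
    derivative (Polynomial.Chebyshev.S R (2 * (m : ℤ) + 2)) = ∑ k ∈ Finset.range (m + 1), ((2 * (k : ℤ) + 2 : ℤ) : R[X]) * Polynomial.Chebyshev.S R (2 * (k : ℤ) + 1) := by
  have h := congrArg derivative (one_add_sum_chebyshevC_even R (m + 1))
  push_cast at h
  rw [show 2 * ((m : ℤ) + 1) = 2 * (m : ℤ) + 2 by ring] at h
  rw [← h, derivative_add, derivative_one, zero_add, derivative_sum]
  refine Finset.sum_congr rfl fun k _ => ?_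
  rw [chebyshevC_derivative_eq_S, show 2 * (k : ℤ) + 2 - 1 = 2 * (k : ℤ) + 1 by ring]

/-- `(Σ_k c_k·S_{j_k})(2X) ′`-transport: `(p(2X))′ = 2·p′(2X)` (Mathlib `derivative_comp`). [this file, §1307] -/
theorem derivative_comp_two_mul_X {R : Type*} [CommRing R] (p : R[X]) : derivative (p.comp (2 * X)) = 2 * (derivative p).comp (2 * X) := by
  rw [Polynomial.derivative_comp, derivative_mul, derivative_ofNat, zero_mul, zero_add, derivative_X, mul_one]

/-- **`U_{2m+1}′ = Σ_{k≤m} 2(2k+1)·U_{2k}`** in every commutative ring (from the `S`-expansion through `U_n = S_n(2X)`, Mathlib `S_comp_two_mul_X`; equivalently: differentiate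
`Literature…ChebyshevExplicitForms.U_two_mul_add_one_eq_two_mul_sum` with `T_j′ = jU_{j−1}`). [Mason–Handscomb 2003, §2.4.5; this file, §1307] -/
theorem derivative_chebyshevU_odd (R : Type*) [CommRing R] (m : ℕ) :
    derivative (Polynomial.Chebyshev.U R (2 * (m : ℤ) + 1)) = ∑ k ∈ Finset.range (m + 1), (2 * ((2 * (k : ℤ) + 1 : ℤ) : R[X])) * Polynomial.Chebyshev.U R (2 * (k : ℤ)) := by
  rw [← Polynomial.Chebyshev.S_comp_two_mul_X, derivative_comp_two_mul_X, derivative_chebyshevS_odd, Polynomial.sum_comp, Finset.mul_sum]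
  refine Finset.sum_congr rfl fun k _ => ?_
  rw [mul_comp, intCast_comp, Polynomial.Chebyshev.S_comp_two_mul_X]
  ring

/-- **`U_{2m+2}′ = Σ_{k≤m} 2(2k+2)·U_{2k+1}`** in every commutative ring (same transport; cf. `Literature…ChebyshevExplicitForms.U_two_mul_eq_one_add_two_mul_sum`). [Mason–Handscomb 2003, §2.4.5; this file, §1307] -/
theorem derivative_chebyshevU_even (R : Type*) [CommRing R] (m : ℕ) :
    derivative (Polynomial.Chebyshev.U R (2 * (m : ℤ) + 2)) = ∑ k ∈ Finset.range (m + 1), (2 * ((2 * (k : ℤ) + 2 : ℤ) : R[X])) * Polynomial.Chebyshev.U R (2 * (k : ℤ) + 1) := by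
  rw [← Polynomial.Chebyshev.S_comp_two_mul_X, derivative_comp_two_mul_X, derivative_chebyshevS_even, Polynomial.sum_comp, Finset.mul_sum]
  refine Finset.sum_congr rfl fun k _ => ?_
  rw [mul_comp, intCast_comp, Polynomial.Chebyshev.S_comp_two_mul_X]
  ring

/-! ### Markov's inequality -/

/-- **Markov for the second kind: `|U_n′(x)| ≤ U_n′(1)` for `|x| ≤ 1`.** [Rivlin 1974, §2.7; Borwein–Erdélyi §5.1; this file, §1307] -/
theorem abs_eval_derivative_chebyshevU_real_le (n : ℕ) {x : ℝ} (hx : |x| ≤ 1) :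
    |(derivative (Polynomial.Chebyshev.U ℝ (n : ℤ))).eval x| ≤ (derivative (Polynomial.Chebyshev.U ℝ (n : ℤ))).eval 1 := by
  have key : ∀ (c : ℕ → ℝ) (j : ℕ → ℕ) (s : Finset ℕ), (∀ k, 0 ≤ c k) →
      |∑ k ∈ s, c k * (Polynomial.Chebyshev.U ℝ (j k : ℤ)).eval x| ≤ ∑ k ∈ s, c k * (Polynomial.Chebyshev.U ℝ (j k : ℤ)).eval 1 := by
    intro c j s hc
    refine (Finset.abs_sum_le_sum_abs _ _).trans (Finset.sum_le_sum fun k _ => ?_)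
    rw [abs_mul, abs_of_nonneg (hc k), Polynomial.Chebyshev.U_eval_one]
    push_cast
    exact mul_le_mul_of_nonneg_left (Literature.Probability.FitznerVanDerHofstad2017.abs_eval_U_le (j k) hx) (hc k)
  obtain ⟨m, rfl | rfl⟩ := Nat.even_or_odd' n
  · cases m with
    | zero => simp
    | succ p =>
      have h := derivative_chebyshevU_even ℝ p
      push_cast at h ⊢
      rw [show (2 * ((p : ℤ) + 1)) = 2 * (p : ℤ) + 2 by ring, h]
      simp only [eval_finsetSum, eval_mul, eval_add, eval_ofNat, eval_natCast]
      have hk := key (fun k => 2 * (2 * (k : ℝ) + 2)) (fun k => 2 * k + 1) (Finset.range (p + 1)) (fun k => by positivity)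
      push_cast at hk ⊢
      exact hk
  · have h := derivative_chebyshevU_odd ℝ m
    push_cast at h ⊢
    rw [h]
    simp only [eval_finsetSum, eval_mul, eval_add, eval_ofNat, eval_natCast, eval_one]
    have hk := key (fun k => 2 * (2 * (k : ℝ) + 1)) (fun k => 2 * k) (Finset.range (m + 1)) (fun k => by positivity)
    push_cast at hk ⊢
    exact hk

/-- `|U_n′(x)| ≤ n(n+1)(n+2)∕3` for `|x| ≤ 1` (Mathlib `derivative_U_eval_one_eq_div`). [Rivlin 1974, (1.98); this file, §1307] -/
theorem abs_eval_derivative_chebyshevU_real_le_explicit (n : ℕ) {x : ℝ} (hx : |x| ≤ 1) :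
    |(derivative (Polynomial.Chebyshev.U ℝ (n : ℤ))).eval x| ≤ (n : ℝ) * (n + 1) * (n + 2) / 3 := by
  have h := abs_eval_derivative_chebyshevU_real_le n hx
  rw [Polynomial.Chebyshev.derivative_U_eval_one_eq_div] at h
  push_cast at h
  linarith

/-- **Markov for the Vieta–Fibonacci polynomials: `|S_n′(x)| ≤ S_n′(2)` for `|x| ≤ 2`.** [Rivlin 1974, §2.7 (rescaled); this file, §1307] -/
theorem abs_eval_derivative_chebyshevS_real_le (n : ℕ) {x : ℝ} (hx : |x| ≤ 2) :
    |(derivative (Polynomial.Chebyshev.S ℝ (n : ℤ))).eval x| ≤ (derivative (Polynomial.Chebyshev.S ℝ (n : ℤ))).eval 2 := by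
  have hx' : |x / 2| ≤ 1 := by rw [abs_div, abs_two]; exact (div_le_one two_pos).mpr hx
  have key : ∀ (c : ℕ → ℝ) (j : ℕ → ℕ) (s : Finset ℕ), (∀ k, 0 ≤ c k) →
      |∑ k ∈ s, c k * (Polynomial.Chebyshev.S ℝ (j k : ℤ)).eval x| ≤ ∑ k ∈ s, c k * (Polynomial.Chebyshev.S ℝ (j k : ℤ)).eval 2 := by
    intro c j s hc
    refine (Finset.abs_sum_le_sum_abs _ _).trans (Finset.sum_le_sum fun k _ => ?_)
    rw [abs_mul, abs_of_nonneg (hc k), Polynomial.Chebyshev.S_eval_two, chebyshevS_eval_eq_U_eval_half]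
    push_cast
    exact mul_le_mul_of_nonneg_left (Literature.Probability.FitznerVanDerHofstad2017.abs_eval_U_le (j k) hx') (hc k)
  obtain ⟨m, rfl | rfl⟩ := Nat.even_or_odd' n
  · cases m with
    | zero => simp
    | succ p =>
      have h := derivative_chebyshevS_even ℝ p
      push_cast at h ⊢
      rw [show (2 * ((p : ℤ) + 1)) = 2 * (p : ℤ) + 2 by ring, h]
      simp only [eval_finsetSum, eval_mul, eval_add, eval_ofNat, eval_natCast]
      have hk := key (fun k => 2 * (k : ℝ) + 2) (fun k => 2 * k + 1) (Finset.range (p + 1)) (fun k => by positivity)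
      push_cast at hk ⊢
      exact hk
  · have h := derivative_chebyshevS_odd ℝ m
    push_cast at h ⊢
    rw [h]
    simp only [eval_finsetSum, eval_mul, eval_add, eval_ofNat, eval_natCast, eval_one]
    have hk := key (fun k => 2 * (k : ℝ) + 1) (fun k => 2 * k) (Finset.range (m + 1)) (fun k => by positivity)
    push_cast at hk ⊢
    exact hk

/-- `|S_n′(x)| ≤ n(n+1)(n+2)∕6` for `|x| ≤ 2` (N513 `six_mul_derivative_S_eval_two`). [Rivlin 1974, (1.98) (rescaled); this file, §1307] -/
theorem abs_eval_derivative_chebyshevS_real_le_explicit (n : ℕ) {x : ℝ} (hx : |x| ≤ 2) :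
    |(derivative (Polynomial.Chebyshev.S ℝ (n : ℤ))).eval x| ≤ (n : ℝ) * (n + 1) * (n + 2) / 6 := by
  have h := abs_eval_derivative_chebyshevS_real_le n hx
  have h6 := six_mul_derivative_S_eval_two (R := ℝ) (n : ℤ)
  push_cast at h6
  linarith

end Summit.Ventures.HSemireg.Wedge.HankelOuter
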